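import Literature.Topology.FourManifolds.GluckTwistExistenceFramed
import Literature.Topology.FourManifolds.TwoKnotNormalEuler
import HarnessLib

/-!
# Discharge of `Literature.Topology.FourManifolds.TwoKnot.nonempty_normalFraming` (Kirby, Ch. VIII, Thm. 2 for `S² ⊆ S⁴`)

Topic `Literature/Topology/FourManifolds`; proofs file for the named fact of
`FramedTubularNbhd.lean`:

* `Literature.Topology.FourManifolds.TwoKnot.nonempty_normalSection_holds` — every 2-knot `K : S² ↪ S⁴` admits a nowhere-zero
  normal vector field (the named fact of `TwoKnotNormalSection.lean`), from
  `Literature.Topology.FourManifolds.TwoKnotNormalSection.exists_isNormalFraming_one` (`TwoKnotNormalEuler.lean`);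
* `Literature.Topology.FourManifolds.TwoKnot.nonempty_normalFraming_holds` — **the normal bundle of a 2-knot is trivial**
  (the named fact `Literature.Topology.FourManifolds.TwoKnot.nonempty_normalFraming`, Kirby, *The Topology of 4-Manifolds*
  (1989), Ch. VIII, Thm. 2, p. 44, case `M = S²`, `Q = S⁴`), by the orientation step
  `Literature.Topology.FourManifolds.TwoKnot.nonempty_normalFraming_of_nonempty_normalSection` (`TwoKnotNormalSection.lean`);
* `Literature.Topology.FourManifolds.TwoKnot.nonempty_tubularNbhd_holds` — hence every 2-knot has a tubular neighbourhood
  `S² × ℝ² ↪ S⁴` (the named fact `Literature.Topology.FourManifolds.TwoKnot.nonempty_tubularNbhd` of `GluckTwist.lean`, via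
  `Literature.Topology.FourManifolds.TwoKnot.nonempty_tubularNbhd_of_nonempty_normalFraming`, `FramedTubularNbhd.lean`);
* `Literature.Topology.FourManifolds.exists_isGluckTwist_holds`, `Literature.Topology.FourManifolds.gluck_exists_holds` — hence the Gluck twist of `S⁴`
  along any 2-knot exists (the named facts `Literature.Topology.FourManifolds.exists_isGluckTwist` of `GluckTwist.lean` and
  `Literature.Topology.FourManifolds.gluck_exists` of `GluckTwistFacts.lean`, via the reductions of
  `GluckTwistExistenceFramed.lean`; Gluck (1962), §§6, 8, 17).

The proof chain: `SphereMapsMissPoints.lean` (a 2-knot misses a pair of antipodal points) →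
`TwoKnotNormalSection.lean` (cross products, radial extension, orientation step) →
`TwoKnotNormalTube.lean` (normal projections, injectivity radius, nearest points) →
`TwoKnotNormalEuler.lean` (Kirby's extended plane field, transport along chords, smoothing).

## References

* R. C. Kirby, *The Topology of 4-Manifolds*, LNM 1374, Springer (1989), Ch. VIII, Thm. 2
  (p. 44) and Thm. 3 (p. 45). [Kirby1989]
* H. Gluck, *The embedding of two-spheres in the four-sphere*, Trans. Amer. Math. Soc. 104 (1962),
  308–333, §§6, 8, 17 (cited through `GluckTwistExistenceFramed.lean`). [GluckTAMS1962]
-/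

open scoped Manifold ContDiff
open Function

noncomputable section

namespace Literature.Topology.FourManifolds

open TwoKnotNormalSection

/-- **Discharge of the named fact `Literature.Topology.FourManifolds.TwoKnot.nonempty_normalSection`**: every 2-knot
`K : S² ↪ S⁴` admits a nowhere-zero normal vector field (Kirby, *The Topology of 4-Manifolds*
(1989), Ch. VIII, Thm. 2: the Euler class of the normal bundle of a null-homologous codimension-2
submanifold vanishes — here realised by transporting Kirby's extended plane field `ξ` along chords
of `S⁴`). [cite: Kirby1989, Ch. VIII Thm. 2] -/
theorem TwoKnot.nonempty_normalSection_holds : TwoKnot.nonempty_normalSection := fun K => by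
  obtain ⟨F, _, _, hF⟩ := K.isSmoothEmbedding.isImmersion
  obtain ⟨s, hs⟩ := exists_isNormalFraming_one K.contMDiff
    (fun x => Manifold.IsImmersionAtOfComplement.mfderiv_injective (hF x) (by simp)) K.injective
  exact ⟨_, hs⟩

/-- **Discharge of the named fact `Literature.Topology.FourManifolds.TwoKnot.nonempty_normalFraming`** (`FramedTubularNbhd.lean`):
*the normal bundle of a 2-knot is trivial* — every smooth 2-knot `K : S² ↪ S⁴` admits a normal
framing. Kirby, *The Topology of 4-Manifolds* (LNM 1374, 1989), Ch. VIII, Thm. 2, p. 44, case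
`M = S²`, `Q = S⁴`: the nowhere-zero normal field (`TwoKnot.nonempty_normalSection_holds`) plus
the orientation step (`TwoKnot.nonempty_normalFraming_of_nonempty_normalSection`).
[cite: Kirby1989, Ch. VIII Thm. 2] -/
theorem TwoKnot.nonempty_normalFraming_holds : TwoKnot.nonempty_normalFraming :=
  TwoKnot.nonempty_normalFraming_of_nonempty_normalSection TwoKnot.nonempty_normalSection_holds

/-- With the discharge, **every 2-knot has a tubular neighbourhood** `S² × ℝ² ↪ S⁴`
(`Literature.Topology.FourManifolds.TwoKnot.nonempty_tubularNbhd`, hence the Gluck twist exists). [cite: Kirby1989, Ch. VIII Thms. 2–3] -/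
theorem TwoKnot.nonempty_tubularNbhd_holds : TwoKnot.nonempty_tubularNbhd :=
  TwoKnot.nonempty_tubularNbhd_of_nonempty_normalFraming TwoKnot.nonempty_normalFraming_holds

/-- **Discharge of the named fact `Literature.Topology.FourManifolds.exists_isGluckTwist`** (`GluckTwist.lean`): the Gluck twist
of `S⁴` along any 2-knot exists (Gluck 1962, §§6, 8, 17, via
`exists_isGluckTwist_of_nonempty_normalFraming`). [cite: GluckTAMS1962, §§8 and 17] -/
theorem exists_isGluckTwist_holds : exists_isGluckTwist :=
  exists_isGluckTwist_of_nonempty_normalFraming TwoKnot.nonempty_normalFraming_holds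

/-- **Discharge of the route-facing named fact `Literature.Topology.FourManifolds.gluck_exists`** (`GluckTwistFacts.lean`).
[cite: GluckTAMS1962, §§8 and 17] -/
theorem gluck_exists_holds : gluck_exists :=
  gluck_exists_of_nonempty_normalFraming TwoKnot.nonempty_normalFraming_holds

end Literature.Topology.FourManifolds
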